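import Summits.ResolutionOfSingularities.ResolutionOfSingularities.Theorems.PurelyInseparableDim4JointWaitingNodeDefsTwo
import Summits.ResolutionOfSingularities.ResolutionOfSingularities.Theorems.PurelyInseparableDim4JointShapeSurvivalSees
import Summits.ResolutionOfSingularities.ResolutionOfSingularities.Theorems.PurelyInseparableDim4JointSurvival
import HarnessLib

/-!
# Purely inseparable four-folds: a coordinate member WITH ITS WAITING REGIONS SURVIVES the blow-up of a disjoint member — the
# `MemberData` form (brick S3 (c) «joint point∘coordinate chains», part 51 = v3 threading, survival; cell `res-dim4-pi`)

[OURS · counted 0] (D-0157 DOOR 2; desk WORD #66 (4)(c), #74 (g), #99 (d); frame `PIDim4.TerminationImpliesOrderReduction`, S3 (c) v3;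
host item stmt-ResolutionOfSingularities-16155, helper). Nothing here proves resolution of singularities in dimension ≥ 4 / characteristic
`p` — NOT here, not anywhere in this programme.

The survivor half of the threading node step (memo `S3c-V3LITE-LANDED.md`, item 4), packaged against part 49/49b's names: if a member `c`
of a node `(X′, M′)` carries `MemberData` (state `s`, centre `S`, waiting entries `Wt` with regions `wr`) and is disjoint — together with its
waiting regions — from the centre `V(C)` being blown up (`π : W → X′`), then its preimage carries `MemberData` at `(W, M′.transform π C)`
with the SAME state, centre and waiting entries and the preimage regions `π⁻¹ wr`. Ingredients: part 9 (`member_survival_global`),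
part 47 (`member_survival_zigzag_shape_sees`: chart, shape AND visibility of the regions), the rest of the datum is combinatorial.

* **`memberData_survival`**.

AI-produced formalisation, weaker than expert review. bears_on: LADDER-RESOLUTION:D157-DOOR2 (res-dim4-pi · S3 (c) joint v3 · threading).
-/

set_option linter.dupNamespace false -- D-0017: single-problem summit path `Summit.<S>.<S>.…` by design

noncomputable section

open MvPolynomial Finset CategoryTheory AlgebraicGeometry Opposite TopologicalSpace
open AlgebraicGeometry.Scheme.IdealSheafData (ofIdealTop vanishingIdeal)

namespace Summit.ResolutionOfSingularities.ResolutionOfSingularities.Theorems.PIDim4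

open Literature.AlgebraicGeometry.Resolution
open Literature.AlgebraicGeometry.Resolution.Hauser2010
open Literature.AlgebraicGeometry.Resolution.AffinePointBlowup (P A γ coord Wtop ξ)

namespace Equimultiple

section Survival

variable {K : Type} [Field K] {p : ℕ} [hp : Fact p.Prime] [CharP K p] [DecidableEq K]
variable {X' W : Scheme.{0}} {π : W ⟶ X'} {Ce : X'.IdealSheafData}

/-- **A MEMBER WITH ITS WAITING REGIONS SURVIVES THE BLOW-UP OF A DISJOINT CENTRE.** See the module docstring.
[cite: BierstoneGrigorievMilmanWlodarczyk2011, Def. 3.1.3 (2), (4)] [cite: StacksProject, Tag 02OS] -/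
theorem memberData_survival [IsAlgClosed K] [IsLocallyNoetherian X'] [IsLocallyNoetherian W] (hπ : IsBlowup π Ce)
    (M' : MarkedIdeal X') (hmult : M'.mult = p) (hsncC : HasSNCWith M'.boundary Ce)
    (plan : State K → Finset (Fin 4) → Finset (Fin 4 × (Fin 4 → K) × Finset (Fin 4)))
    (leaves : State K → Finset (Fin 4) → Finset (Fin 4 × (Fin 4 → K)))
    (c : Closeds X') (hdisj : Disjoint (c : Set X') (Ce.support : Set X')) {s : State K} {S : Finset (Fin 4)}
    {Wt : Finset (Fin 4 × (Fin 4 → K) × Finset (Fin 4))} {wr : Fin 4 × (Fin 4 → K) × Finset (Fin 4) → Closeds X'}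
    (h : MemberData p plan leaves M' c s S Wt wr) (hregdisj : ∀ wt ∈ Wt, Disjoint (wr wt : Set X') (Ce.support : Set X')) :
    MemberData p plan leaves (M'.transform π Ce) (c.preimage π.continuous) s S Wt (fun wt => (wr wt).preimage π.continuous) := by
  obtain ⟨hF, hclean, hS, hreg, hsnc, hchart, hown, hbelow, hacc, hwait, hW2, hPW⟩ := h
  obtain ⟨Y, φ, ψ, _, _, hM, hZ, hcφ, hsee, ⟨idx, cst_, hshape, hinj⟩, hregions⟩ := hchart
  -- global survival
  obtain ⟨hreg', -, hsnc'⟩ := member_survival_global hπ M' c hdisj hreg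
    (coe_member_subset_support φ ψ M' hmult _ hM hS.2 c hZ hcφ) hsncC hsnc
  -- the survivor chart with shape and visibility
  obtain ⟨Y', φ', ψ', _, _, hM', hZ', hcφ', hsee', hvis, idx₂, cst₂, hshape₂, hinj₂⟩ :=
    member_survival_zigzag_shape_sees hπ c hdisj φ ψ M'.ideal (hypSheaf p s.F) hM M'.mult hZ hcφ hsee M'.boundary idx cst_
      hshape hinj
  -- visibility of each waiting region survives
  have hvis' : ∀ wt ∈ Wt, waitingSet wt ⊆ Set.range ψ' ∧
      φ' '' (ψ' ⁻¹' waitingSet wt) = π ⁻¹' (wr wt : Set X') ∧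
      ∀ B ∈ (M'.transform π Ce).boundary, Disjoint (B.support : Set W) (π ⁻¹' (wr wt : Set X')) := by
    intro wt hwt
    obtain ⟨hweq, hwsee⟩ := hregions wt hwt
    have hbd := (hwait wt hwt).2.2.2.2.2.2
    obtain ⟨h1, h2, -, h4⟩ := hvis (waitingSet wt) hwsee (by rw [← hweq]; exact (wr wt).isClosed)
      (fun B hB => by rw [← hweq]; exact hbd B hB) (by rw [← hweq]; exact hregdisj wt hwt)
    rw [← hweq] at h2
    refine ⟨h1, h2, fun B hB => ?_⟩
    rw [← h2]
    exact h4 B hB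
  refine ⟨hF, hclean, hS, hreg', hsnc', ⟨Y', φ', ψ', inferInstance, inferInstance, hM', hZ', hcφ', hsee',
    ⟨idx₂, cst₂, hshape₂, hinj₂⟩, fun wt hwt => ?_⟩, hown, hbelow, hacc, fun wt hwt => ?_, hW2, hPW⟩
  · -- the preimage region is seen through the survivor chart
    obtain ⟨h1, h2, -⟩ := hvis' wt hwt
    exact ⟨by rw [h2]; rfl, h1⟩
  · -- waiting data: unchanged, with the new boundary missing the preimage region
    obtain ⟨hj, hc0, hsub, hjT, hperm, haccw, -⟩ := hwait wt hwt
    obtain ⟨-, -, h4⟩ := hvis' wt hwt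
    exact ⟨hj, hc0, hsub, hjT, hperm, haccw, fun D hD => h4 D hD⟩

end Survival

end Equimultiple

end Summit.ResolutionOfSingularities.ResolutionOfSingularities.Theorems.PIDim4

end
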